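import Summits.ResolutionOfSingularities.ResolutionOfSingularities.Theorems.HomologicalConductorNoZenoPNonemptyNegDef
import Summits.ResolutionOfSingularities.ResolutionOfSingularities.Theorems.HomologicalConductorNoZenoBaseIdealPNonempty
import HarnessLib

/-!
# Crux `NoZenoR` (stmt-ResolutionOfSingularities-19943), (B1) split core STEP 3 (1) BY NAME, FACT-FREE:
# `P = {E : (Z·E) < 0} ≠ ∅` for the exceptional cycle `Z` of an `𝔪`-primary base ideal principalised on the fibre

Route `ResolutionOfSingularities/HomologicalConductor`.  OURS (cell decomp-res, LAND-ONLY hand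
leafhand-res-homologicalconduct-12 g0); nothing here is a statement of a manuscript under review; AI-written, weaker than
expert review.  Helper `--supports stmt-ResolutionOfSingularities-19943`.

The by-name node `ExcCount.exists_excCurveDegree_baseIdealDivisor_neg` (`…NoZenoBaseIdealPNonempty`, binders
`(h121 : Lipman1969_12_1_i) (hH1 : HasTrivialCechH1 π)`) and its consumer-facing form
`ExcCount.exists_excCurveDegree_baseIdealDivisor_neg_of_hasRationalSingularity` (`…NoZenoChartFibreCurves`, binders
`(h12 : Lipman1969_1_2) (h121 : Lipman1969_12_1_i) (hrat : HasRationalSingularity T)`) re-proved with NONE of those binders,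
over `exists_excCurveDegree_neg_of_isEffective_of_supp` (`…NoZenoPNonemptyNegDef`: du Val negative definiteness, tree theorem
`Lipman1969_14_1_holds`):

* `exists_excCurveDegree_baseIdealDivisor_neg_negDef` — for a resolution `π : X → Spec T` of a two-dimensional normal
  Noetherian local domain and an ideal `𝔞 ≠ 0` with `𝔪ᶜ ≤ 𝔞 ≤ 𝔪` whose extension `𝔞·𝒪_(X,x)` is principal wherever
  `T → 𝒪_(X,x)` is local, the base ideal sheaf `𝔞𝒪_X` is an effective Cartier divisor `Z` and `(Z·E_η) < 0` for some integral
  exceptional curve — the literal conclusion of both tree nodes, with the argument list of the second MINUS `h12 h121 hrat`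
  (so `exists_seam1Package*` / `hasSplitExcCurveCountLE_pred_of_finiteCentre` can drop `Lipman1969_12_1_i` from their binders,
  and `Lipman1969_1_2` / rationality at this node);
* `baseIdealDivisor_antinef_and_exists_neg_negDef` — anti-nefness and `P ≠ ∅` in one fact-free statement.
(The packaged STEP 3 (1) of `…NoZenoExcDegreeAvoids`, `exists_excCurveDegree_neg_of_forall_isSection_neg`, minus `h121`/`hH1`
and its then idle `hgen`, IS `exists_excCurveDegree_neg_of_isEffective_of_supp` verbatim.)

References: J. Lipman, Publ. Math. IHÉS 36 (1969), Lemma (14.1) (p. 224) [`Lipman1969`]; res-L0-w44-stub-2 (L1)-PREP v2 §2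
STEP 3 (1) (OURS).
-/

noncomputable section

-- single-problem summit: the doubled namespace component `ResolutionOfSingularities` is forced
set_option linter.dupNamespace false

namespace Summit.ResolutionOfSingularities.ResolutionOfSingularities.Theorems.NoZeno.ExcCount

open CategoryTheory AlgebraicGeometry TopologicalSpace IsLocalRing
open Literature.AlgebraicGeometry Literature.AlgebraicGeometry.Resolution Literature.AlgebraicGeometry.Motives

variable {T : Type} [CommRing T] [IsLocalRing T] [IsDomain T] [IsNoetherianRing T] [IsIntegrallyClosed T]
  {X : Scheme.{0}} [IsIntegral X] [IsLocallyNoetherian X] {π : X ⟶ Spec (.of T)}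

/-- **STEP 3 (1) BY NAME — `P ≠ ∅`, FACT-FREE.**  For a resolution `π : X → Spec T` of a two-dimensional normal Noetherian local
domain and an ideal `𝔞 ≠ 0` with `𝔪ᶜ ≤ 𝔞 ≤ 𝔪` whose extension `𝔞·𝒪_(X,x)` is principal at every point where `T → 𝒪_(X,x)` is
local: the base ideal sheaf `𝔞𝒪_X` is an effective Cartier divisor and its divisor `Z` has `(Z·E_η) < 0` for some integral
exceptional curve `E_η`.  Same conclusion as `exists_excCurveDegree_baseIdealDivisor_neg` /
`exists_excCurveDegree_baseIdealDivisor_neg_of_hasRationalSingularity`, with the binders `Lipman1969_12_1_i`, `HasTrivialCechH1 π`,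
`Lipman1969_1_2`, `HasRationalSingularity T` all gone (du Val negative definiteness instead of (12.1) (i)).
[cite: Lipman1969, Lemma (14.1) (p. 224)] -/
theorem exists_excCurveDegree_baseIdealDivisor_neg_negDef (hdim : ringKrullDim T = 2)
    (hπ : IsResolution π) {𝔞 : Ideal T} (h𝔞0 : 𝔞 ≠ ⊥) {c : ℕ}
    (hc : maximalIdeal T ^ c ≤ 𝔞) (h𝔞 : 𝔞 ≤ maximalIdeal T)
    (hprin : ∀ x : X, IsLocalHom (toStalk π x) → (𝔞.map (toStalk π x)).IsPrincipal) :
    ∃ hJ : IsEffectiveCartier (Scheme.IdealSheafData.ofIdealTop (𝔞.map (Morphisms.algebraMapΓ π))),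
      ∃ η ∈ excCurvePoints π, excCurveDegree π (CartierDivisor.ofIsEffectiveCartier _ hJ) η < 0 := by
  haveI : IsProper π := hπ.isProper
  haveI : IsDominant π := hπ.isBirational.isDominant
  have hJ := isEffectiveCartier_baseIdeal π h𝔞0 hc hprin
  exact ⟨hJ, exists_excCurveDegree_neg_of_isEffective_of_supp hdim hπ _
    (baseIdealDivisor_isEffective π hJ) (fun x hx => baseIdealDivisor_avoids_of_base_ne π hJ hc h𝔞 hx)
    (exists_not_avoids_baseIdealDivisor π hJ hc h𝔞)⟩

/-- **Anti-nefness AND `P ≠ ∅` together** (the two outputs of `…NoZenoBaseIdealPNonempty` in one fact-free statement): the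
exceptional cycle `Z` of the base ideal has `(Z·E_η) ≤ 0` for every integral exceptional curve and `< 0` for some.
[cite: Lipman1969, Lemma (14.1) (p. 224); Lipman1969, Section 12, Remark 2 c) (p. 221)] -/
theorem baseIdealDivisor_antinef_and_exists_neg_negDef (hdim : ringKrullDim T = 2)
    (hπ : IsResolution π) {𝔞 : Ideal T} (h𝔞0 : 𝔞 ≠ ⊥) {c : ℕ}
    (hc : maximalIdeal T ^ c ≤ 𝔞) (h𝔞 : 𝔞 ≤ maximalIdeal T)
    (hprin : ∀ x : X, IsLocalHom (toStalk π x) → (𝔞.map (toStalk π x)).IsPrincipal) :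
    ∃ hJ : IsEffectiveCartier (Scheme.IdealSheafData.ofIdealTop (𝔞.map (Morphisms.algebraMapΓ π))),
      (∀ η ∈ excCurvePoints π, excCurveDegree π (CartierDivisor.ofIsEffectiveCartier _ hJ) η ≤ 0) ∧
      ∃ η ∈ excCurvePoints π, excCurveDegree π (CartierDivisor.ofIsEffectiveCartier _ hJ) η < 0 := by
  haveI : IsProper π := hπ.isProper
  obtain ⟨hJ, η, hη, hlt⟩ := exists_excCurveDegree_baseIdealDivisor_neg_negDef hdim hπ h𝔞0 hc h𝔞 hprin
  exact ⟨hJ, fun η' hη' => excCurveDegree_baseIdealDivisor_nonpos hJ hη', η, hη, hlt⟩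

end Summit.ResolutionOfSingularities.ResolutionOfSingularities.Theorems.NoZeno.ExcCount

end
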